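import Summits.BirchSwinnertonDyer.BirchSwinnertonDyer.Theorems.SignedLowerHalvesSmallImageLowerHalfBothSignsRttCharRoadE1TowerLayers
import Summits.BirchSwinnertonDyer.BirchSwinnertonDyer.Theorems.EisensteinPrimesUnramifiedLeAwayKer
import Summits.BirchSwinnertonDyer.BirchSwinnertonDyer.Theorems.ThetaPartnerAtTwoSignedKatoUpToAtTwoFineSandwich
import Summits.BirchSwinnertonDyer.Rank1Residual.X2.GreenbergVatsalUnramifiedAway
import Literature.NumberTheory.EllipticCurves.AnticyclotomicSignedSelmer
import Literature.NumberTheory.EllipticCurves.AnticyclotomicSignedLocalConditions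
import Literature.NumberTheory.EllipticCurves.TwoVariableSelmerDual
import HarnessLib

/-!
# Route `SignedLowerHalves`, crux L `SmallImageLowerHalfBothSigns` (stmt-BirchSwinnertonDyer-23599), line `rtt_w3` v11→v12 — glue brick L3-top / D4-ℚ
# («layer `n` ⟹ Kim's group at infinite level»): a class `η ∈ H¹(ℚ_n, W[p^∞])` (`H = κ.layerSubgroup n`, `κ` CYCLOTOMIC, `p` odd) killed by `p`,
# unramified outside `S₀ ∪ {p}` (all conjugates, `S₀ ⊇` bad primes) and satisfying Kobayashi's `ε`-Kummer condition from `E^ε(ℚ_n·ℚ_p)` at every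
# place above `p` (all conjugates) restricts to a `p`-torsion class of B. D. Kim's non-primitive signed Selmer group AT INFINITE LEVEL
# `AcSigned.selmer W p κ S₀ (fun _ ↦ .sgn ε)` — every ℚ-side local condition being a TREE lemma at infinite level
# (HELPER-TABLE v11 addendum 3: `v ∉ S₀`, `v ∤ p`: unramified ⟹ `awayKer` over `ℚ_∞` (`UnramifiedLeAwayKer.unramifiedKer_le_awayKer_of_not_decomp_le` +
# `inertia_le_kerSubgroup_of_isCyclotomic` / `not_decomp_le_kerSubgroup_of_isCyclotomic`); `∞`: `SignedKatoOffTwo.FineSandwich.mem_infKer_of_odd_nsmul_eq_zero`; at `p`: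
# `AcSigned.map_resOfLe_localKummerOverOfEmb_le` + `AcSigned.localKummerOverOfEmb_signedLocalPointsOfEmb_le`).

LEAD `cruxlead-stmt-BirchSwinnertonDyer-23599` g7 (cell `bsd-ssimc`; `--supports stmt-BirchSwinnertonDyer-23599 --as helper`). THEOREMS ONLY (no definition,
no named fact, no instance, no `sorry`). This is the LAST arrow of the glue `injTop_of_bricks` (cores route, memo `Lines/rtt_w3-MEMO-D3c-w3g17.md` §5/§7):
the corestricted classes `cor ξ_j ∈ H¹(ℚ_n, W[p^∞])` produced by the hands' bricks (D3-a unramified transport p764060/p764811, D3-W at `p`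
p766412/`…E1LocalCores`) are turned into elements of the byte-exact INJ_top target `{x : AcSigned.selmer W p κ ↑S₀ (fun _ ↦ .sgn ε) | p • x = 0}`.
BSD / crux L / INJ_top are NOT proved here.

WHAT: `conjH1_resOfLe_eq`, `unramifiedKer_kerSubgroup_le_awayKer_of_isCyclotomic` (ANY `v ∤ p` over the cyclotomic tower, `M = W[p^∞]`),
★ `resOfLe_mem_acSignedSelmer_of_layer` (membership) and ★ `resOfLe_mem_acSignedSelmer_pTorsion_of_layer` (the element of the target type, as a
conjunction `∈ ∧ p • _ = 0`).

References: [BDKim2009] pp. 182, 185 (Kim's group at infinite level); [GreenbergVatsal2000] §2 p. 17 («unramified = locally trivial» at `η ∤ p` over `ℚ_∞`);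
[Greenberg1989] §1 p. 98 (3); [Kobayashi2003] Def. 1.1; [SerreGaloisCohomology1997] I §2.4.
-/

set_option autoImplicit false
set_option linter.dupNamespace false -- D-0017: single-problem summit, the namespace repeats the problem name by design
noncomputable section

open scoped Classical

namespace Summit.BirchSwinnertonDyer.BirchSwinnertonDyer.Theorems.SmallImageCharSignedSelmer

open NumberField IsDedekindDomain Field
open Literature.NumberTheory.EllipticCurves Literature.NumberTheory.EllipticCurves.GreenbergSelmer
  Literature.NumberTheory.EllipticCurves.GreenbergVatsal2000 Literature.NumberTheory.GaloisRepresentations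
  Literature.NumberTheory.EllipticCurves.Kobayashi2003 Literature.NumberTheory.EllipticCurves.AcSigned
  Summit.BirchSwinnertonDyer.Rank1Residual WeierstrassCurve

section LayerToTop

variable {W : WeierstrassCurve ℚ} {p : ℕ} [Fact p.Prime] (κ : ZpExtension ℚ p)

/-- Restriction to `Gal(ℚ̄/ℚ_∞)` commutes with conjugation by `σ ∈ Γ_ℚ` (`resOfLe_comp_conjH1_holds`, pointwise form).
[cite: SerreGaloisCohomology1997, I §5.8] -/
theorem conjH1_resOfLe_eq {n : ℕ} (σ : absoluteGaloisGroup ℚ) (η : W.subgroupH1 p (κ.layerSubgroup n)) :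
    W.conjH1 p κ.kerSubgroup σ (W.resOfLe p (κ.kerSubgroup_le_layerSubgroup n) η) =
      W.resOfLe p (κ.kerSubgroup_le_layerSubgroup n) (W.conjH1 p (κ.layerSubgroup n) σ η) := by
  change ((conjH1 κ.kerSubgroup (W.geomPrimaryTorsion p) σ).comp (resOfLe (W.geomPrimaryTorsion p) (κ.kerSubgroup_le_layerSubgroup n))) η =
    ((resOfLe (W.geomPrimaryTorsion p) (κ.kerSubgroup_le_layerSubgroup n)).comp (conjH1 (κ.layerSubgroup n) (W.geomPrimaryTorsion p) σ)) η
  rw [resOfLe_comp_conjH1_holds]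

/-- **Unramified ⟹ locally trivial at a good `v ∤ p` over the CYCLOTOMIC `ℤ_p`-tower of `ℚ`, for `M = W[p^∞]`** (`I_v ≤ Γ_∞`, `D_v ⊄ Γ_∞`; Greenberg: «one
could replace `I_v` by `D_v`»). [cite: GreenbergVatsal2000, §2 p. 17] [cite: Greenberg1989, §1 p. 98 (3)] -/
theorem unramifiedKer_kerSubgroup_le_awayKer_of_isCyclotomic (hκ : κ.IsCyclotomic) {v : HeightOneSpectrum (𝓞 ℚ)}
    (hpv : ((p : ℕ) : 𝓞 ℚ) ∉ v.asIdeal) :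
    unramifiedKer κ.kerSubgroup (W.geomPrimaryTorsion p) v ≤ awayKer κ.kerSubgroup (W.geomPrimaryTorsion p) v :=
  UnramifiedLeAwayKer.unramifiedKer_le_awayKer_of_not_decomp_le κ (AcSigned.isOpen_stabilizer_geomPrimaryTorsion W)
    (W.exists_pow_smul_geomPrimaryTorsion_eq_zero p)
    (X2.GreenbergVatsalUnramifiedAway.inertia_le_kerSubgroup_of_isCyclotomic κ v hκ hpv)
    (X2.GreenbergVatsalUnramifiedAway.not_decomp_le_kerSubgroup_of_isCyclotomic κ v hκ hpv)

/-- ★ **Layer `n` ⟹ Kim's group at infinite level (membership).** `κ` cyclotomic, `p` odd, ANY `S₀` (no good-reduction hypothesis is needed: over `ℚ_∞`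
«unramified ⟹ locally trivial» at `v ∤ p` holds for every discrete `p`-primary module); `η ∈ H¹(ℚ_n, W[p^∞])` with
`p • η = 0`, unramified outside `S₀ ∪ {p}` (all conjugates) and, at every `v ∣ p` and every conjugate, in Kobayashi's Kummer condition from
`E^ε(ℚ_n·ℚ_v)`; then `res_{ℚ_∞} η ∈ S^{S₀,ε}(ℚ_∞, W[p^∞]) = AcSigned.selmer W p κ S₀ (fun _ ↦ .sgn ε)`. Away from `p`: unramified descends along
`res` (`resOfLe_mem_unramifiedKer`) and is local triviality over `ℚ_∞` (`unramifiedKer_kerSubgroup_le_awayKer_of_isCyclotomic`); at `∞`: odd torsion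
(`mem_infKer_of_odd_nsmul_eq_zero`); at `p`: `AcSigned.map_resOfLe_localKummerOverOfEmb_le`, `AcSigned.localKummerOverOfEmb_signedLocalPointsOfEmb_le`.
[cite: BDKim2009, pp. 182, 185] [cite: GreenbergVatsal2000, §2 p. 17] [cite: Kobayashi2003, Def. 1.1] -/
theorem resOfLe_mem_acSignedSelmer_of_layer (hp : p ≠ 2) (hκ : κ.IsCyclotomic) (S₀ : Set (HeightOneSpectrum (𝓞 ℚ))) (ε : ℤˣ) {n : ℕ}
    (η : W.subgroupH1 p (κ.layerSubgroup n)) (hηp : p • η = 0)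
    (hunr : η ∈ unramifiedOutside (κ.layerSubgroup n) (W.geomPrimaryTorsion p) p S₀)
    (hsgn : ∀ v : HeightOneSpectrum (𝓞 ℚ), ((p : ℕ) : 𝓞 ℚ) ∈ v.asIdeal → ∀ σ : absoluteGaloisGroup ℚ,
      W.conjH1 p (κ.layerSubgroup n) σ η ∈
        localKummerOverOfEmb W p (κ.layerSubgroup n) (closureEmb (K := ℚ) (v.adicCompletion ℚ))
          (signedLocalPoints κ (v.adicCompletion ℚ) W ε n)) :
    W.resOfLe p (κ.kerSubgroup_le_layerSubgroup n) η ∈ selmer W p κ S₀ (fun _ ↦ PCond.sgn ε) := by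
  rw [mem_selmer_iff]
  refine ⟨?_, fun v hpv ↦ ?_⟩
  · rw [mem_awayConditions_iff]
    refine ⟨fun v hpv hvS σ ↦ ?_, fun w σ ↦ ?_⟩
    · -- `v ∤ p`, `v ∉ S₀`: unramified at layer `n` ⟹ unramified over `ℚ_∞` ⟹ locally trivial over `ℚ_∞`
      rw [conjH1_resOfLe_eq]
      have hunr' : W.conjH1 p (κ.layerSubgroup n) σ η ∈ unramifiedKer (κ.layerSubgroup n) (W.geomPrimaryTorsion p) v :=
        (mem_unramifiedOutside_iff _).1 hunr v hvS hpv σ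
      exact unramifiedKer_kerSubgroup_le_awayKer_of_isCyclotomic κ hκ hpv
        (resOfLe_mem_unramifiedKer (M := W.geomPrimaryTorsion p) (κ.kerSubgroup_le_layerSubgroup n) v hunr')
    · -- infinite places: `p` odd
      rw [conjH1_resOfLe_eq]
      refine SignedKatoOffTwo.FineSandwich.mem_infKer_of_odd_nsmul_eq_zero (H := κ.kerSubgroup) (M := W.geomPrimaryTorsion p) (w := w)
        (hn := (Fact.out : p.Prime).odd_of_ne_two hp) (c := _) ?_
      rw [← map_nsmul, ← map_nsmul, hηp, map_zero, map_zero]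
  · -- places above `p`: layer-`n` Kummer condition ⟹ `signedKummerInfty`
    rw [mem_condAbove_sgn_iff]
    intro σ
    rw [conjH1_resOfLe_eq]
    exact localKummerOverOfEmb_signedLocalPointsOfEmb_le W p κ (closureEmb (K := ℚ) (v.adicCompletion ℚ)) ε n
      (map_resOfLe_localKummerOverOfEmb_le W p (closureEmb (K := ℚ) (v.adicCompletion ℚ)) (κ.kerSubgroup_le_layerSubgroup n)
        (signedLocalPointsOfEmb κ (closureEmb (K := ℚ) (v.adicCompletion ℚ)) W ε n) ⟨_, hsgn v hpv σ, rfl⟩)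

/-- ★ **Layer `n` ⟹ an element of the INJ_top target `{x : AcSigned.selmer W p κ S₀ (fun _ ↦ .sgn ε) | p • x = 0}`** (membership and `p`-torsion,
bundled as a conjunction for the glue). [cite: BDKim2009, pp. 182, 185] [cite: Kobayashi2003, Def. 1.1] -/
theorem resOfLe_mem_acSignedSelmer_pTorsion_of_layer (hp : p ≠ 2) (hκ : κ.IsCyclotomic) (S₀ : Set (HeightOneSpectrum (𝓞 ℚ))) (ε : ℤˣ) {n : ℕ}
    (η : W.subgroupH1 p (κ.layerSubgroup n)) (hηp : p • η = 0)
    (hunr : η ∈ unramifiedOutside (κ.layerSubgroup n) (W.geomPrimaryTorsion p) p S₀)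
    (hsgn : ∀ v : HeightOneSpectrum (𝓞 ℚ), ((p : ℕ) : 𝓞 ℚ) ∈ v.asIdeal → ∀ σ : absoluteGaloisGroup ℚ,
      W.conjH1 p (κ.layerSubgroup n) σ η ∈
        localKummerOverOfEmb W p (κ.layerSubgroup n) (closureEmb (K := ℚ) (v.adicCompletion ℚ))
          (signedLocalPoints κ (v.adicCompletion ℚ) W ε n)) :
    (⟨W.resOfLe p (κ.kerSubgroup_le_layerSubgroup n) η,
        resOfLe_mem_acSignedSelmer_of_layer κ hp hκ S₀ ε η hηp hunr hsgn⟩ : selmer W p κ S₀ (fun _ ↦ PCond.sgn ε)) ∈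
      {x : selmer W p κ S₀ (fun _ ↦ PCond.sgn ε) | p • x = 0} := by
  rw [Set.mem_setOf_eq]
  exact Subtype.ext (by rw [AddSubgroupClass.coe_nsmul, ← map_nsmul, hηp, map_zero]; rfl)

end LayerToTop

end Summit.BirchSwinnertonDyer.BirchSwinnertonDyer.Theorems.SmallImageCharSignedSelmer

end
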